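import Summits.CriticalPhenomena.PercolationContinuityZ3.Theorems.PercNearOneGluingNoHeavyLowerTailCILPortDomination
import Summits.CriticalPhenomena.PercolationContinuityZ3.Theorems.PercNearOneGluingNoHeavyLowerTailCILEdgeRaising
import Literature.Probability.Percolation.LonelyClusterExchange
import HarnessLib

/-!
# `NoHeavyLowerTail` (stmt-CriticalPhenomena-4575) — CIL for a relay-neighboured observer: domination of the ports in ANY
# SUB-STAR REFERENCE suffices (deletion–contraction of the observer's own edges)

Support file (prover `prim-hp-2`, hull-port / deletion–contraction line; `--supports stmt-CriticalPhenomena-4575`).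
No definitions, no named facts, no sorries.

Setting as in `Theorems.cil_relayNeighbours_port` / `Theorems.cil_of_portDomination`: `μ_w = prodBernoulli w` on `Fin n`, relays
`A`, level `j`, an observer `o ∉ A` all of whose positive-weight neighbours are among the ports `p 0, …, p (d−1) ∈ A` (`p` injective,
`d ≥ 1`); `N = |π(o)|`, `π(x) = {a ∈ A : x ↔ a}`.  The two landed witness rules say that a relay `b` dominating every port — lightness
`μ{|π(·)| ≤ j}` measured either in `G − o` (all edges at `o` deleted; `cil_relayNeighbours_port` + separation stability) or in `G` itself
(`cil_of_portDomination`) — is a valid CIL witness: `μ{1 ≤ N ≤ j} ≤ μ{|π(b)| ≤ j}`.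

This file interpolates between the two: for ANY set `F` of port indices let `w_F` be `w` with the edges `o–p l`, `l ∈ F`, switched off
(a SUB-STAR REFERENCE: `F = ∅` is `G`, `F = univ` is `G − o`).  If `b ∈ A` dominates every port in `w_F`, then `b` is a valid CIL
witness in `w` (`cil_of_subStarDomination`).

Proof (deletion–contraction of the observer's edges `F`, i.e. iterated edge raising `CutObserver.setCS_raise_edge`): by downward
induction on the set `S ⊆ F` of still-deleted edges one proves set-champion stability `CS_{w_S}({o} ∪ p(Y), b)` for every `Y ⊆ S`;
at `S = F` the set `{o} ∪ p(Y)` with `Y ≠ ∅` contains a dominated relay (lonelier-member exchange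
`Literature.….observerSet_le_of_lonelier`, van den Berg–Häggström–Kahn Thm 1.5) and `Y = ∅` is `cil_of_portDomination` in `w_F`
(rewritten as `CS({o}, b)` by `setCS_singleton_of_cil`); restoring one edge `o–p l` is `setCS_raise_edge` (resp.
`setCS_raise_edge_witness` when `p l = b`); at `S = ∅`, `CS_w({o}, b)` is the claim (`cil_of_setCS_singleton`).
-/

noncomputable section

namespace Summit.CriticalPhenomena.PercolationContinuityZ3.Theorems

open MeasureTheory Set Literature.Probability.LatticeModels Literature.Probability.Percolation
open scoped Classical BigOperators

variable {n : ℕ}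

namespace SubStar

/-- CIL at `o` with a RELAY witness `q ∈ A` gives set-champion stability for the singleton `{o}`:
`μ(q ↮ o, 1 ≤ N ≤ j) ≤ μ(q ↮ o, |π(q)| ≤ j)` (on `{q ↔ o}` the two events coincide because `q ∈ π(q) = π(o)`).
Converse of `Theorems.cil_of_setCS_singleton`. [folklore] -/
theorem setCS_singleton_of_cil (w : Sym2 (Fin n) → unitInterval) (A : Finset (Fin n)) (o q : Fin n) (j : ℕ)
    (hqA : q ∈ A)
    (hcil : (prodBernoulli w).real {ω : BondConfig (Fin n) |
        1 ≤ (A.filter fun x => ω ∈ openConn o x).card ∧ (A.filter fun x => ω ∈ openConn o x).card ≤ j} ≤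
      (prodBernoulli w).real {ω : BondConfig (Fin n) | (A.filter fun x => ω ∈ openConn q x).card ≤ j}) :
    (prodBernoulli w).real {ω : BondConfig (Fin n) | (∀ x ∈ ({o} : Finset (Fin n)), ω ∉ openConn q x) ∧
        1 ≤ (A.filter fun z => ∃ x ∈ ({o} : Finset (Fin n)), ω ∈ openConn x z).card ∧
        (A.filter fun z => ∃ x ∈ ({o} : Finset (Fin n)), ω ∈ openConn x z).card ≤ j} ≤
      (prodBernoulli w).real {ω : BondConfig (Fin n) | (∀ x ∈ ({o} : Finset (Fin n)), ω ∉ openConn q x) ∧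
        (A.filter fun z => ω ∈ openConn q z).card ≤ j} := by
  haveI : IsProbabilityMeasure (prodBernoulli w) := inferInstance
  set μ := prodBernoulli w with hμ
  set L := {ω : BondConfig (Fin n) |
    1 ≤ (A.filter fun x => ω ∈ openConn o x).card ∧ (A.filter fun x => ω ∈ openConn o x).card ≤ j} with hL
  set R := {ω : BondConfig (Fin n) | (A.filter fun x => ω ∈ openConn q x).card ≤ j} with hR
  set V := (openConn q o : Set (BondConfig (Fin n))) with hV
  have hfo : ∀ ω, (A.filter fun z => ∃ x ∈ ({o} : Finset (Fin n)), ω ∈ openConn x z) =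
      (A.filter fun x => ω ∈ openConn o x) := by
    intro ω
    refine Finset.filter_congr fun z _ => ?_
    simp only [Finset.mem_singleton, exists_eq_left]
  have hLV : L \ V = {ω : BondConfig (Fin n) | (∀ x ∈ ({o} : Finset (Fin n)), ω ∉ openConn q x) ∧
      1 ≤ (A.filter fun z => ∃ x ∈ ({o} : Finset (Fin n)), ω ∈ openConn x z).card ∧
      (A.filter fun z => ∃ x ∈ ({o} : Finset (Fin n)), ω ∈ openConn x z).card ≤ j} := by
    ext ω
    constructor
    · rintro ⟨⟨h1, h2⟩, hVω⟩
      refine ⟨fun x hx => ?_, ?_, ?_⟩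
      · rw [Finset.mem_singleton] at hx; subst hx; exact hVω
      · rw [hfo ω]; exact h1
      · rw [hfo ω]; exact h2
    · rintro ⟨hsep, h1, h2⟩
      refine ⟨⟨?_, ?_⟩, hsep o (Finset.mem_singleton_self o)⟩
      · rw [hfo ω] at h1; exact h1
      · rw [hfo ω] at h2; exact h2
  have hRV : R \ V = {ω : BondConfig (Fin n) | (∀ x ∈ ({o} : Finset (Fin n)), ω ∉ openConn q x) ∧
      (A.filter fun z => ω ∈ openConn q z).card ≤ j} := by
    ext ω
    constructor
    · rintro ⟨h2, hVω⟩
      refine ⟨fun x hx => ?_, h2⟩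
      rw [Finset.mem_singleton] at hx; subst hx; exact hVω
    · rintro ⟨hsep, h2⟩
      exact ⟨h2, hsep o (Finset.mem_singleton_self o)⟩
  have hin : R ∩ V ⊆ L ∩ V := by
    rintro ω ⟨hRω, hVω⟩
    refine ⟨?_, hVω⟩
    have hqo : (openGraph ω).Reachable q o := hVω
    have heq : (A.filter fun x => ω ∈ openConn q x) = (A.filter fun x => ω ∈ openConn o x) :=
      Finset.filter_congr fun x _ => ⟨fun h => hqo.symm.trans h, fun h => hqo.trans h⟩
    have hRω' : (A.filter fun x => ω ∈ openConn q x).card ≤ j := hRω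
    refine ⟨?_, ?_⟩
    · show 1 ≤ (A.filter fun x => ω ∈ openConn o x).card
      rw [← heq]
      apply Finset.card_pos.2
      refine ⟨q, ?_⟩
      rw [Finset.mem_filter]
      exact ⟨hqA, show (openGraph ω).Reachable q q from SimpleGraph.Reachable.refl _⟩
    · show (A.filter fun x => ω ∈ openConn o x).card ≤ j
      rw [← heq]; exact hRω'
  have hsL := measureReal_inter_add_sdiff (μ := μ) (s := L) (MeasurableSet.of_discrete (s := V)) (measure_ne_top _ _)
  have hsR := measureReal_inter_add_sdiff (μ := μ) (s := R) (MeasurableSet.of_discrete (s := V)) (measure_ne_top _ _)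
  have h1 : μ.real (R ∩ V) ≤ μ.real (L ∩ V) := measureReal_mono hin (measure_ne_top _ _)
  have h2 : μ.real L ≤ μ.real R := hcil
  rw [← hLV, ← hRV]
  linarith

/-- The sub-star reference weight function: the edges `o – p l`, `l ∈ S`, switched off. -/
theorem subStar_apply_of_not (w : Sym2 (Fin n) → unitInterval) (o : Fin n) {d : ℕ} (p : Fin d → Fin n)
    (S : Finset (Fin d)) (e : Sym2 (Fin n)) (he : ¬ ∃ l ∈ S, e = s(o, p l)) :
    (fun e' => if ∃ l ∈ S, e' = s(o, p l) then (0 : unitInterval) else w e') e = w e := by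
  simp only [he, if_false]

/-- Switching off one more edge: `(w_{S.erase l})[s(o, p l) ↦ 0] = w_S` for `l ∈ S`. -/
theorem update_subStar_erase (w : Sym2 (Fin n) → unitInterval) (o : Fin n) {d : ℕ} (p : Fin d → Fin n)
    (S : Finset (Fin d)) {l : Fin d} (hl : l ∈ S) :
    Function.update (fun e => if ∃ m ∈ S.erase l, e = s(o, p m) then (0 : unitInterval) else w e) s(o, p l) 0 =
      fun e => if ∃ m ∈ S, e = s(o, p m) then (0 : unitInterval) else w e := by
  funext e
  by_cases he : e = s(o, p l)
  · subst he
    rw [Function.update_self]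
    have : ∃ m ∈ S, s(o, p l) = s(o, p m) := ⟨l, hl, rfl⟩
    simp only [this, if_true]
  · rw [Function.update_of_ne he]
    by_cases h1 : ∃ m ∈ S.erase l, e = s(o, p m)
    · obtain ⟨m, hm, hme⟩ := h1
      have h2 : ∃ m ∈ S, e = s(o, p m) := ⟨m, Finset.mem_of_mem_erase hm, hme⟩
      simp only [h2, if_true, ite_eq_left_iff]
      intro h; exact absurd ⟨m, hm, hme⟩ h
    · have h2 : ¬ ∃ m ∈ S, e = s(o, p m) := by
        rintro ⟨m, hm, hme⟩
        by_cases hml : m = l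
        · subst hml; exact he hme
        · exact h1 ⟨m, Finset.mem_erase.2 ⟨hml, hm⟩, hme⟩
      simp only [h1, h2, if_false]

end SubStar

open SubStar CutObserver in
/-- **CIL for a relay-neighboured observer from port domination in a SUB-STAR REFERENCE.**  Let `o ∉ A` have all its
positive-weight neighbours among the ports `p 0, …, p (d−1) ∈ A` (`p` injective, `d ≥ 1`), let `F` be any set of port indices and
`w_F` the weight function with the edges `o – p l`, `l ∈ F`, switched off (the rest of the weighted graph, including the other edges at
`o`, unchanged).  If `b ∈ A` is at least as often light as every port, lightness `μ{|π(·)| ≤ j}` being measured in `w_F`, then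
`μ_w{1 ≤ N ≤ j} ≤ μ_w{|π(b)| ≤ j}` — the conclusion of `stub_cumulativeIsolation` (crux `NoHeavyLowerTail`, stmt-CriticalPhenomena-4575)
with the witness `b`.  `F = ∅` is `Theorems.cil_of_portDomination` (reference `G`), `F = univ` the `G − o` rule behind
`Theorems.cil_relayNeighbours_port`; every intermediate reference is new.  Mechanism: deletion–contraction of the edges in `F`
(`CutObserver.setCS_raise_edge`), the contracted branches being set-champion stabilities for `{o} ∪ p(Y)`, `∅ ≠ Y ⊆ F`, which hold in
`w_F` by the lonelier-member exchange. [cite: VandenbergHaggstromKahn2005, Thm. 1.5 (p. 7) — via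
`Literature.Probability.Percolation.LonelyClusterExchange.observerSet_le_of_lonelier`] -/
theorem cil_of_subStarDomination (w : Sym2 (Fin n) → unitInterval) (A : Finset (Fin n)) (o : Fin n) (j : ℕ) {d : ℕ}
    (p : Fin d → Fin n) (hp : Function.Injective p) (hpA : ∀ l, p l ∈ A) (hoA : o ∉ A) (hd : 0 < d)
    (hobs : ∀ v, w s(o, v) ≠ 0 → ∃ l, v = p l) (F : Finset (Fin d)) (b : Fin n) (hb : b ∈ A)
    (hdom : ∀ l : Fin d,
      (prodBernoulli (fun e => if ∃ m ∈ F, e = s(o, p m) then (0 : unitInterval) else w e)).real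
          {ω : BondConfig (Fin n) | (A.filter fun x => ω ∈ openConn (p l) x).card ≤ j} ≤
        (prodBernoulli (fun e => if ∃ m ∈ F, e = s(o, p m) then (0 : unitInterval) else w e)).real
          {ω : BondConfig (Fin n) | (A.filter fun x => ω ∈ openConn b x).card ≤ j}) :
    (prodBernoulli w).real {ω : BondConfig (Fin n) |
        1 ≤ (A.filter fun x => ω ∈ openConn o x).card ∧ (A.filter fun x => ω ∈ openConn o x).card ≤ j} ≤
      (prodBernoulli w).real {ω : BondConfig (Fin n) | (A.filter fun x => ω ∈ openConn b x).card ≤ j} := by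
  -- notation for the sub-star references and the set-champion-stability statement
  let wS : Finset (Fin d) → Sym2 (Fin n) → unitInterval :=
    fun S e => if ∃ m ∈ S, e = s(o, p m) then (0 : unitInterval) else w e
  let CS : (Sym2 (Fin n) → unitInterval) → Finset (Fin n) → Prop := fun u T =>
    (prodBernoulli u).real {ω : BondConfig (Fin n) |
        (∀ x ∈ T, ω ∉ openConn b x) ∧ 1 ≤ (A.filter fun z => ∃ x ∈ T, ω ∈ openConn x z).card ∧
        (A.filter fun z => ∃ x ∈ T, ω ∈ openConn x z).card ≤ j} ≤
      (prodBernoulli u).real {ω : BondConfig (Fin n) |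
        (∀ x ∈ T, ω ∉ openConn b x) ∧ (A.filter fun z => ω ∈ openConn b z).card ≤ j}
  have hbo : b ≠ o := fun h => hoA (h ▸ hb)
  -- base of the downward induction: every `{o} ∪ p(Y)`, `Y ⊆ F`, in the reference `w_F`
  have hbase : ∀ Y : Finset (Fin d), Y ⊆ F → CS (wS F) (insert o (Y.image p)) := by
    intro Y hYF
    dsimp only [CS]
    by_cases hY : Y = ∅
    · subst hY
      simp only [Finset.image_empty, insert_empty_eq]
      -- `CS({o}, b)` in `w_F` from `cil_of_portDomination` in `w_F`
      have hobsF : ∀ v, wS F s(o, v) ≠ 0 → ∃ l, v = p l := by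
        intro v hv
        apply hobs v
        intro h0
        apply hv
        show (if ∃ m ∈ F, s(o, v) = s(o, p m) then (0 : unitInterval) else w s(o, v)) = 0
        by_cases hex : ∃ m ∈ F, s(o, v) = s(o, p m)
        · simp only [hex, if_true]
        · simp only [hex, if_false]; exact h0
      have hcil := cil_of_portDomination (wS F) A o j p hp hpA hoA hd hobsF b hdom
      exact setCS_singleton_of_cil (wS F) A o b j hb hcil
    · obtain ⟨y, hy⟩ := Finset.nonempty_iff_ne_empty.2 hY
      have hpy : p y ∈ insert o (Y.image p) :=
        Finset.mem_insert_of_mem (Finset.mem_image_of_mem p hy)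
      convert observerSet_le_of_lonelier (wS F) A (insert o (Y.image p)) (p y) b hpy j (hdom y) using 12
  -- downward induction on the set of still-deleted edges
  have hstep : ∀ k : ℕ, ∀ S : Finset (Fin d), S ⊆ F → S.card + k = F.card →
      ∀ Y : Finset (Fin d), Y ⊆ S → CS (wS S) (insert o (Y.image p)) := by
    intro k
    induction k with
    | zero =>
      intro S hSF hcard Y hYS
      have hSF' : S = F := Finset.eq_of_subset_of_card_le hSF (by omega)
      subst hSF'
      exact hbase Y hYS
    | succ k ih =>
      intro S hSF hcard Y hYS
      -- pick an index of `F` outside `S` and restore that edge last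
      have hlt : S.card < F.card := by omega
      obtain ⟨l, hlF, hlS⟩ := Finset.exists_of_ssubset (Finset.ssubset_iff_subset_ne.2 ⟨hSF, fun h => by
        rw [h] at hlt; exact lt_irrefl _ hlt⟩)
      -- `S' = insert l S` has one more deleted edge; IH applies to it
      have hS'F : insert l S ⊆ F := Finset.insert_subset hlF hSF
      have hcard' : (insert l S).card + k = F.card := by rw [Finset.card_insert_of_notMem hlS]; omega
      have hIH := ih (insert l S) hS'F hcard'
      -- `wS S = (wS (insert l S)) with the edge `o – p l` restored`, i.e. updating it back to 0 gives `wS (insert l S)`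
      have hupd : Function.update (wS S) s(o, p l) 0 = wS (insert l S) := by
        have := update_subStar_erase w o p (insert l S) (Finset.mem_insert_self l S)
        rw [Finset.erase_insert hlS] at this
        exact this
      have hoT : o ∈ insert o (Y.image p) := Finset.mem_insert_self _ _
      have hopl : o ≠ p l := fun h => hoA (h ▸ hpA l)
      dsimp only [CS]
      by_cases hplb : p l = b
      · -- restoring the witness's own edge
        have h₀ : CS (Function.update (wS S) s(o, p l) 0) (insert o (Y.image p)) := by
          rw [hupd]; exact hIH Y (hYS.trans (Finset.subset_insert l S))
        dsimp only [CS] at h₀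
        have hbT : b ∉ insert o (Y.image p) := by
          intro hmem
          rcases Finset.mem_insert.1 hmem with h | h
          · exact hbo h
          · obtain ⟨m, hmY, hm⟩ := Finset.mem_image.1 h
            have : m = l := hp (hm.trans hplb.symm)
            subst this
            exact hlS (hYS hmY)
        rw [hplb] at h₀
        exact setCS_raise_edge_witness (wS S) A (insert o (Y.image p)) o b j hoT hbT h₀
      · have h₀ : CS (Function.update (wS S) s(o, p l) 0) (insert o (Y.image p)) := by
          rw [hupd]; exact hIH Y (hYS.trans (Finset.subset_insert l S))
        have h₁ : CS (Function.update (wS S) s(o, p l) 0) (insert (p l) (insert o (Y.image p))) := by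
          rw [hupd]
          have e1 : insert (p l) (insert o (Y.image p)) = insert o ((insert l Y).image p) := by
            rw [Finset.image_insert, Finset.insert_comm]
          rw [e1]
          exact hIH (insert l Y) (Finset.insert_subset_insert l hYS)
        dsimp only [CS] at h₀ h₁
        exact setCS_raise_edge (wS S) A (insert o (Y.image p)) o (p l) b j hoT hopl h₀ h₁
  -- conclusion at `S = ∅`, `Y = ∅`
  have hfin := hstep F.card ∅ (Finset.empty_subset F) (by simp) ∅ (Finset.empty_subset _)
  dsimp only [CS] at hfin
  simp only [Finset.image_empty, insert_empty_eq] at hfin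
  have hw : wS ∅ = w := by
    funext e
    simp [wS]
  rw [hw] at hfin
  exact cil_of_setCS_singleton w A o b j hfin

end Summit.CriticalPhenomena.PercolationContinuityZ3.Theorems

end
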